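import Summits.Langlands.Langlands.Theorems.IrreducibilityBySelfDualityIrreducibleOffSectorOfWeak
import Summits.Langlands.Langlands.Theorems.IrreducibilityBySelfDualityIrreducibleOffSectorIsobaricRigidityOfRank
import Literature.NumberTheory.Automorphic.PairLFunctionPolesRepDataRankTwo
import HarnessLib

/-!
# The pointwise weak bootstrap with Arthur–Clozel (2.3) only below the rank — unconditional in (2.3)
# up to rank three
(crux stmt-Langlands-14329 `IrreducibilityBySelfDuality.IrreducibleOffSector`, line `Sketch`;
`--supports` file, STRUCTURAL: no import of the route module)

`isIrreducible_of_geometric_of_weakAutomorphyBelow` (p112357) takes Arthur–Clozel (2.3) for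
Borel–Jacquet data as the all-ranks named fact.  The isobaric rigidity it invokes compares `π` on
`GL_n` with blocks of ranks `m_i < n`, and (2.3) enters only for pairs of blocks of equal rank
(`isobaricRigidity_of_JS_of_rank`, p114518).  Hence:

* `isIrreducible_of_geometric_of_weakAutomorphyBelow_of_rank` — the same bootstrap with (2.3)
  required only for pairs of cuspidal data on `GL_m(𝔸_K)`, `0 < m < n`;
* `isIrreducible_of_geometric_of_weakAutomorphyBelow_of_le_three` — for `n ≤ 3` the (2.3) input is a
  THEOREM of the tree in the ranks `1, 2` that occur
  (`JacquetShalika1981_partialPairL_pole_repData_rank_of_le_two`: Hecke in rank one, the tree's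
  `JacquetShalika1981_partialPairL_pole_of_eq_conj_holds_two` in rank two), so one pinned-geometric
  avatar of `π` on `GL_n(𝔸_K)`, `n ≤ 3`, plus weak automorphy of irreducible pinned-geometric
  representations of ranks `< n`, plus Arthur–Clozel (2.2), make every a.e.-compatible `ρ` irreducible.

References: F. Calegari, T. Gee, Ann. Inst. Fourier 63 (2013), §1.1; H. Jacquet, J. Shalika, Amer. J.
Math. 103 (1981) II, Thm. 4.4; J. Arthur, L. Clozel, Ann. of Math. Stud. 120, Ch. 3 §2.
-/

noncomputable section

set_option linter.dupNamespace false

open scoped NumberField Classical Polynomial Topology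
open Filter IsDedekindDomain Polynomial
open Literature.NumberTheory.Automorphic Literature.NumberTheory.GaloisRepresentations
open Summit.Langlands

namespace Summit.Langlands.Langlands.Theorems.IrreducibleOffSector

/-- **The pointwise weak bootstrap, (2.3) only below the rank** (Calegari–Gee 2013, §1.1): granted
Arthur–Clozel (2.2) for Borel–Jacquet data and (2.3) for pairs of cuspidal data on `GL_m(𝔸_K)` for
`0 < m < n`, if a cuspidal `π` on `GL_n(𝔸_K)` (`n ≥ 1`) has ONE avatar `ρ₀` unramified a.e., de Rham
above `ℓ` (pinned datum) and Satake–Frobenius compatible with `(π, ι)` a.e., and irreducible such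
representations of every rank `0 < m < n` are weakly automorphic, then every `ρ : Γ_K → GL_n(ℚ̄_ℓ)`
compatible with `(π, ι)` a.e. is irreducible. [cite: CalegariGee2013, §1.1] -/
theorem isIrreducible_of_geometric_of_weakAutomorphyBelow_of_rank
    (h22 : JacquetShalika1981_partialPairL_boundary_repData)
    {K : Type} [Field K] [NumberField K] {n : ℕ}
    (h23 : ∀ m : ℕ, 0 < m → m < n →
      ∀ (τ₂ τ₂' : CuspidalAutomorphicRepData m K (isCompact_glFiniteIntegralLevel_holds m K)),
      ∃ S₀ : Set (HeightOneSpectrum (𝓞 K)), S₀.Finite ∧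
        ∀ {S : Set (HeightOneSpectrum (𝓞 K))} (_hS : S.Finite) (_hS₀ : S₀ ⊆ S)
          {α β : SatakeFamily K} (_hα : ∀ w ∉ S, τ₂.1.HasSatakeParamAt w (α w))
          (_hβ : ∀ w ∉ S, τ₂'.1.HasSatakeParamAt w (β w))
          (_hu : ∀ w ∉ S, ‖(α w).prod‖ = 1) (_hu' : ∀ w ∉ S, ‖(β w).prod‖ = 1)
          {s₀ : ℂ} (_hs₀ : s₀.re = 1)
          (_hX : ∀ᶠ w in cofinite,
            (α w).map (((w.residueCard : ℂ) ^ (1 - s₀)) * ·) = (β w).map (·⁻¹)),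
          ∃ c : ℂ, c ≠ 0 ∧
            Tendsto (fun s => (s - s₀) * partialPairL S α β s) (𝓝[{s : ℂ | 1 < s.re}] s₀) (𝓝 c))
    {hcpt : isCompact_glFiniteIntegralLevel n K}
    (hn : 0 < n) (π : CuspidalAutomorphicRepData n K hcpt) {ℓ : ℕ} [Fact ℓ.Prime]
    (ι : PadicAlgCl ℓ ≃+* ℂ) {ρ₀ : FramedGaloisRep K (PadicAlgCl ℓ) n}
    (hgeo₀ : (∀ᶠ v : HeightOneSpectrum (𝓞 K) in cofinite, ρ₀.IsUnramifiedAt v) ∧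
      ∀ (v : HeightOneSpectrum (𝓞 K)) (hv : ((ℓ : ℕ) : 𝓞 K) ∈ v.asIdeal),
        (Literature.NumberTheory.PAdicHodge.fontainePstAdicCompletion v ℓ hv).IsDeRhamFramed
          (ρ₀.toLocal v))
    (hρ₀ : ∀ᶠ v : HeightOneSpectrum (𝓞 K) in cofinite, SatakeFrobCompatibleAt ι π.1 ρ₀ v)
    (hBw : ∀ m : ℕ, 0 < m → m < n → ∀ (hm : isCompact_glFiniteIntegralLevel m K)
      (r : FramedGaloisRep K (PadicAlgCl ℓ) m), r.toGaloisRep.IsIrreducible →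
      ((∀ᶠ v : HeightOneSpectrum (𝓞 K) in cofinite, r.IsUnramifiedAt v) ∧
        ∀ (v : HeightOneSpectrum (𝓞 K)) (hv : ((ℓ : ℕ) : 𝓞 K) ∈ v.asIdeal),
          (Literature.NumberTheory.PAdicHodge.fontainePstAdicCompletion v ℓ hv).IsDeRhamFramed
            (r.toLocal v)) →
      ∃ σ : CuspidalAutomorphicRepData m K hm,
        ∀ᶠ v : HeightOneSpectrum (𝓞 K) in cofinite, SatakeFrobCompatibleAt ι σ.1 r v)
    (ρ : FramedGaloisRep K (PadicAlgCl ℓ) n)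
    (hρ : ∀ᶠ v : HeightOneSpectrum (𝓞 K) in cofinite, SatakeFrobCompatibleAt ι π.1 ρ v) :
    ρ.toGaloisRep.IsIrreducible := by
  suffices hirr₀ : ρ₀.toGaloisRep.IsIrreducible from
    isIrreducible_of_satakeFrobCompatible π.1 ι hirr₀ hρ₀ hρ
  -- the pinned-geometric constituents of `ρ₀`
  obtain ⟨k, m, r, -, hr, hchar, -, hone⟩ :=
    Summit.Langlands.Langlands.Theorems.ReciprocityUpToIrreducibility.exists_geometricConstituents
      Summit.Langlands.Langlands.Theorems.ReciprocityUpToIrreducibility.stub_deRhamBlocks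
      K ℓ ρ₀ hn hgeo₀
  by_cases hk1 : k = 1
  · exact hone hk1
  have hk2 : 2 ≤ k := by
    rcases Nat.lt_or_ge k 2 with hlt | hge
    · interval_cases k
      · have hsum := sum_rank_eq_of_charpoly_eq_prod ρ₀ r 1 (hchar 1)
        simp at hsum
        omega
      · exact absurd rfl hk1
    · exact hge
  have hsum : ∑ i, m i = n := sum_rank_eq_of_charpoly_eq_prod ρ₀ r 1 (hchar 1)
  have hlt : ∀ i, m i < n := rank_lt_of_two_le hsum hk2 fun i => (hr i).1
  -- (B_w) below `n` makes every constituent weakly automorphic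
  have hσ : ∀ i, ∃ σ : CuspidalAutomorphicRepData (m i) K
      (isCompact_glFiniteIntegralLevel_holds (m i) K),
      ∀ᶠ v : HeightOneSpectrum (𝓞 K) in cofinite, SatakeFrobCompatibleAt ι σ.1 (r i) v :=
    fun i => hBw (m i) (hr i).1 (hlt i) _ (r i) (hr i).2.1 (hr i).2.2
  choose σ hσc using hσ
  -- isobaric rigidity forbids `k ≥ 2`; (2.3) is needed only in the block ranks `m i < n`
  refine (isobaricRigidity_of_JS_of_rank h22 K n hcpt hn π k m
    (fun i => isCompact_glFiniteIntegralLevel_holds (m i) K)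
    (fun i τ₂ τ₂' => h23 (m i) (hr i).1 (hlt i) τ₂ τ₂') σ hk2 (fun i => (hr i).1) ?_).elim
  have hall : ∀ᶠ v : HeightOneSpectrum (𝓞 K) in cofinite,
      ∀ i, SatakeFrobCompatibleAt ι (σ i).1 (r i) v :=
    Filter.eventually_all.mpr hσc
  filter_upwards [hρ₀, hall] with v hv hvi
  intro α hα
  obtain ⟨α₀, hα₀, -, hcp⟩ := hv
  obtain rfl : α = α₀ := AutomorphicRepData.hasSatakeParamAt_unique_holds π.1 hα hα₀
  choose β hβ _hurβ hcpβ using hvi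
  refine ⟨β, hβ, ?_⟩
  have hprod : ρ₀.HasFrobCharpolyAt v (∏ i, arithFrobPolyOfSatake ι v.residueCard 1 (β i)) := by
    intro 𝔓 h𝔓 τ hτ
    rw [hchar τ]
    exact Finset.prod_congr rfl fun i _ => hcpβ i 𝔓 h𝔓 τ hτ
  rw [← arithFrobPolyOfSatake_sum] at hprod
  have heq : arithFrobPolyOfSatake ι v.residueCard 1 α =
      arithFrobPolyOfSatake ι v.residueCard 1 (∑ i, β i) :=
    GaloisRep.HasFrobCharpolyAt.unique_holds
      ((FramedGaloisRep.hasFrobCharpolyAt_toGaloisRep_iff v _ ρ₀).mpr hcp)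
      ((FramedGaloisRep.hasFrobCharpolyAt_toGaloisRep_iff v _ ρ₀).mpr hprod)
  exact arithFrobPolyOfSatake_one_injective ι _ heq

/-- **Up to rank three, (2.3) is a theorem**: granted Arthur–Clozel (2.2) for Borel–Jacquet data
ONLY, if a cuspidal `π` on `GL_n(𝔸_K)` with `1 ≤ n ≤ 3` has one a.e.-unramified, de Rham (pinned
datum) avatar compatible with `(π, ι)` a.e., and irreducible such representations of ranks `0 < m < n`
are weakly automorphic, then every `ρ : Γ_K → GL_n(ℚ̄_ℓ)` compatible with `(π, ι)` a.e. is irreducible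
— the blocks have rank `≤ 2`, where (2.3) is `JacquetShalika1981_partialPairL_pole_repData_rank_of_le_two`.
[cite: CalegariGee2013, §1.1] -/
theorem isIrreducible_of_geometric_of_weakAutomorphyBelow_of_le_three
    (h22 : JacquetShalika1981_partialPairL_boundary_repData)
    {K : Type} [Field K] [NumberField K] {n : ℕ} (hn3 : n ≤ 3)
    {hcpt : isCompact_glFiniteIntegralLevel n K}
    (hn : 0 < n) (π : CuspidalAutomorphicRepData n K hcpt) {ℓ : ℕ} [Fact ℓ.Prime]
    (ι : PadicAlgCl ℓ ≃+* ℂ) {ρ₀ : FramedGaloisRep K (PadicAlgCl ℓ) n}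
    (hgeo₀ : (∀ᶠ v : HeightOneSpectrum (𝓞 K) in cofinite, ρ₀.IsUnramifiedAt v) ∧
      ∀ (v : HeightOneSpectrum (𝓞 K)) (hv : ((ℓ : ℕ) : 𝓞 K) ∈ v.asIdeal),
        (Literature.NumberTheory.PAdicHodge.fontainePstAdicCompletion v ℓ hv).IsDeRhamFramed
          (ρ₀.toLocal v))
    (hρ₀ : ∀ᶠ v : HeightOneSpectrum (𝓞 K) in cofinite, SatakeFrobCompatibleAt ι π.1 ρ₀ v)
    (hBw : ∀ m : ℕ, 0 < m → m < n → ∀ (hm : isCompact_glFiniteIntegralLevel m K)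
      (r : FramedGaloisRep K (PadicAlgCl ℓ) m), r.toGaloisRep.IsIrreducible →
      ((∀ᶠ v : HeightOneSpectrum (𝓞 K) in cofinite, r.IsUnramifiedAt v) ∧
        ∀ (v : HeightOneSpectrum (𝓞 K)) (hv : ((ℓ : ℕ) : 𝓞 K) ∈ v.asIdeal),
          (Literature.NumberTheory.PAdicHodge.fontainePstAdicCompletion v ℓ hv).IsDeRhamFramed
            (r.toLocal v)) →
      ∃ σ : CuspidalAutomorphicRepData m K hm,
        ∀ᶠ v : HeightOneSpectrum (𝓞 K) in cofinite, SatakeFrobCompatibleAt ι σ.1 r v)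
    (ρ : FramedGaloisRep K (PadicAlgCl ℓ) n)
    (hρ : ∀ᶠ v : HeightOneSpectrum (𝓞 K) in cofinite, SatakeFrobCompatibleAt ι π.1 ρ v) :
    ρ.toGaloisRep.IsIrreducible :=
  isIrreducible_of_geometric_of_weakAutomorphyBelow_of_rank h22
    (fun m hm hmn τ₂ τ₂' =>
      JacquetShalika1981_partialPairL_pole_repData_rank_of_le_two (by omega) _ hm τ₂ τ₂')
    hn π ι hgeo₀ hρ₀ hBw ρ hρ

end Summit.Langlands.Langlands.Theorems.IrreducibleOffSector

end
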